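import Summits.ValiantsHypothesis.ValiantsHypothesis.Theorems.KPlusLogSqLawTropicalBToeplitzDoublingBipartite

/-!
# Route `KPlusLogSqLaw`, crux `TropicalB` — Toeplitz sector: the BIPARTITE DOUBLING LAW for the quadratic-slope class, `Φ_Q(2n) ≥ Φ_Q(n) + Φ_Q(n)′ − 1`

HONEST FRAMING.  Helper toward the registered stubs `stub_tropThin` / `stub_tropFat` (crux `…Theses.KPlusLogSqLaw.TropicalB`, item
`stmt-ValiantsHypothesis-19771`; cell `pub-symmetroid`, seat `val-sym-trop-p4` (g22), 2026-08-29).  THE DOUBLING LAW of this seat's memo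
(HOME/val-sym-trop-p4/g22/DOUBLING-g22.md §1) in the kernel, for the quadratic-slope class of the cell's Conjecture Q (`Toeplitz.FixedSlopeInstanceBound m (·²)`):
from two size-`n` chains of unique optima of lengths `> N₁` and `> N₂` one size-`(n+n)` chain of length `> N₁ + N₂`:
`¬ FixedSlopeInstanceBound n (·²) N₁ → ¬ FixedSlopeInstanceBound n (·²) N₂ → ¬ FixedSlopeInstanceBound (n+n) (·²) (N₁ + N₂)`
(`fixedSlope_sq_doubling`), i.e. `Φ_Q(2n) ≥ Φ_Q(n) + Φ_Q(n)′ − 1`; with the kernel rows of the construction (`toeplitz_twenty_sq_chain_79`, …) every certified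
row now propagates along doublings (all-`m` floors of linear type).  CONSTRUCTION: positions `[0,n) ∪ [n,2n)`; positive displacements carry instance 1,
negative ones instance 2 shifted by `μ` in slope, plus a footrule reward `C|δ|`; the chain = (members of chain 1, paired with the FROZEN identity on the
right half) followed by (the FROZEN reversal on the left half, paired with members `j ≥ 1` of chain 2); pointwise uniqueness suffices because the identity
and the reversal are the unique extreme optima of the squared displacement (`…DoublingPrelims`), non-bipartite competitors are killed by the footrule
maximum (`…Footrule`), and no collision occurs because the squared displacement is strictly increasing along chains.  LOCATED context (memo §2): the
doubled instances carry many MORE unique optima than the law guarantees (a ladder phase), e.g. `Φ_Q(8,16,32,64) ≥ 19, 57, 185, 650`.  Nothing here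
bounds `Φ_Toep` from above; `ConjectureTPoly` / `TropicalB` stay OPEN; nothing on `MatrixDescartes` or `VP ≠ VNP`.

References: folklore; this seat's memo; `…ToeplitzFootrule` (p705079), `…ToeplitzDoublingPrelims` (p708322), `…ToeplitzDoublingBipartite` (part 1),
`…ToeplitzAdmissible` (`fixedSlopeInstanceBound_iff_free`).
-/

set_option linter.dupNamespace false
set_option autoImplicit false

namespace Summit.ValiantsHypothesis.ValiantsHypothesis.Theorems.KPlusLogSqLaw.Toeplitz

open scoped BigOperators
open Finset

section Doubling

variable {n : ℕ}

/-! ### The law -/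

set_option maxHeartbeats 4000000 in
/-- **THE BIPARTITE DOUBLING LAW, free form**: `¬Free(n, N₁) → ¬Free(n, N₂) → ¬Free(n+n, N₁+N₂)` for the quadratic-slope class.
Members of the doubled chain: `(τ¹_k, id)` at slopes `θ¹_k` (`k = 0..K₁`), then `(rev, τ²_j)` at slopes `μ + θ²_j` (`j = 1..K₂`). -/
theorem not_fixedSlopeFree_sq_double {N₁ N₂ : ℕ}
    (h₁ : ¬ FixedSlopeFreeInstanceBound n (fun δ : ℤ => δ ^ 2) N₁)
    (h₂ : ¬ FixedSlopeFreeInstanceBound n (fun δ : ℤ => δ ^ 2) N₂) :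
    ¬ FixedSlopeFreeInstanceBound (n + n) (fun δ : ℤ => δ ^ 2) (N₁ + N₂) := by
  unfold FixedSlopeFreeInstanceBound at h₁ h₂
  push Not at h₁ h₂
  obtain ⟨α₁, K₁, θ₁, τ₁, hθ₁, hτ₁, hopt₁, hK₁⟩ := h₁
  obtain ⟨α₂, K₂, θ₂, τ₂, hθ₂, hτ₂, hopt₂, hK₂⟩ := h₂
  intro hB
  -- constants
  set A : ℤ := ∑ d ∈ Icc (-(n : ℤ)) n, (|α₁ d| + |α₂ d|) with hAdef
  have hA0 : 0 ≤ A := sum_nonneg fun _ _ => by positivity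
  have hA1 : ∀ d : ℤ, -(n : ℤ) ≤ d → d ≤ n → |α₁ d| ≤ A := fun d hd1 hd2 => by
    have := single_le_sum (f := fun d => |α₁ d| + |α₂ d|) (fun _ _ => by positivity) (mem_Icc.mpr ⟨hd1, hd2⟩)
    have := abs_nonneg (α₂ d); omega
  have hA2 : ∀ d : ℤ, -(n : ℤ) ≤ d → d ≤ n → |α₂ d| ≤ A := fun d hd1 hd2 => by
    have := single_le_sum (f := fun d => |α₁ d| + |α₂ d|) (fun _ _ => by positivity) (mem_Icc.mpr ⟨hd1, hd2⟩)
    have := abs_nonneg (α₁ d); omega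
  set Θ₁ : ℤ := ∑ k, |θ₁ k| with hΘ₁def
  set Θ₂ : ℤ := ∑ j, |θ₂ j| with hΘ₂def
  have hΘ₁ : ∀ k, |θ₁ k| ≤ Θ₁ := fun k => single_le_sum (f := fun k => |θ₁ k|) (fun _ _ => abs_nonneg _) (mem_univ k)
  have hΘ₂ : ∀ j, |θ₂ j| ≤ Θ₂ := fun j => single_le_sum (f := fun j => |θ₂ j|) (fun _ _ => abs_nonneg _) (mem_univ j)
  have hΘ₁0 : 0 ≤ Θ₁ := sum_nonneg fun _ _ => abs_nonneg _
  have hΘ₂0 : 0 ≤ Θ₂ := sum_nonneg fun _ _ => abs_nonneg _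
  set μ : ℤ := Θ₁ + Θ₂ + 2 * n * A + 1 with hμdef
  have hμ0 : 0 ≤ μ := by positivity
  set G : ℤ := A + μ * (n : ℤ) ^ 2 with hGdef
  set Θ : ℤ := Θ₁ + μ + Θ₂ with hΘdef
  set S : ℤ := Θ * (((n : ℤ) + n) * ((n : ℤ) + n) ^ 2) + ((n : ℤ) + n) * G with hSdef
  set C : ℤ := 2 * S + 1 with hCdef
  -- the doubled intercepts
  set g : ℤ → ℤ := fun δ => if 0 < δ then α₁ (δ - n) else if δ < 0 then α₂ (δ + n) - μ * (δ + n) ^ 2 else 0 with hgdef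
  set α' : ℤ → ℤ := fun δ => g δ + C * |δ| with hα'def
  -- the bipartite permutation with halves π, ρ
  let mk : Equiv.Perm (Fin n) → Equiv.Perm (Fin n) → Equiv.Perm (Fin (n + n)) := fun π ρ =>
    finSumFinEquiv.symm.trans ((Equiv.sumCongr π ρ).trans ((Equiv.sumComm (Fin n) (Fin n)).trans finSumFinEquiv))
  have hmkl : ∀ π ρ (a : Fin n), mk π ρ (Fin.castAdd n a) = Fin.natAdd n (π a) := fun π ρ a => mkBip_apply_castAdd π ρ a
  have hmkr : ∀ π ρ (i : Fin n), mk π ρ (Fin.natAdd n i) = Fin.castAdd n (ρ i) := fun π ρ i => mkBip_apply_natAdd π ρ i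
  -- abbreviations for the half weights
  let X : Equiv.Perm (Fin n) → ℤ := fun π => ∑ a : Fin n, (((π a : Fin n) : ℤ) - (a : ℤ)) ^ 2
  let Y₁ : Equiv.Perm (Fin n) → ℤ := fun π => ∑ a : Fin n, α₁ (((π a : Fin n) : ℤ) - (a : ℤ))
  let Y₂ : Equiv.Perm (Fin n) → ℤ := fun π => ∑ a : Fin n, α₂ (((π a : Fin n) : ℤ) - (a : ℤ))
  -- the weight of the doubled instance
  let W : ℤ → Equiv.Perm (Fin (n + n)) → ℤ := fun θ σ =>
    ∑ p : Fin (n + n), (θ * (fun δ : ℤ => δ ^ 2) (((σ p : Fin (n + n)) : ℤ) - (p : ℤ)) + α' (((σ p : Fin (n + n)) : ℤ) - (p : ℤ)))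
  have hWmk : ∀ θ π ρ, W θ (mk π ρ) = θ * (2 * (n : ℤ) ^ 3 + X π + X ρ) + Y₁ π + Y₂ ρ - μ * X ρ + C * (2 * (n : ℤ) ^ 2) :=
    fun θ π ρ => weight_halves α₁ α₂ μ C θ π ρ (mk π ρ) (hmkl π ρ) (hmkr π ρ)
  -- chain weights in the original instances
  have hW1 : ∀ θ (π : Equiv.Perm (Fin n)), ∑ b, (θ * (fun δ : ℤ => δ ^ 2) ((π b : ℤ) - (b : ℤ)) + α₁ ((π b : ℤ) - (b : ℤ))) =
      θ * X π + Y₁ π := fun θ π => by simp only [X, Y₁, sum_add_distrib, ← mul_sum]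
  have hW2 : ∀ θ (π : Equiv.Perm (Fin n)), ∑ b, (θ * (fun δ : ℤ => δ ^ 2) ((π b : ℤ) - (b : ℤ)) + α₂ ((π b : ℤ) - (b : ℤ))) =
      θ * X π + Y₂ π := fun θ π => by simp only [X, Y₂, sum_add_distrib, ← mul_sum]
  -- bounds: |Y_i| ≤ nA, X ≥ 0, generic |θ X' + Σ g| ≤ S for |θ| ≤ Θ
  have hY1 : ∀ π, |Y₁ π| ≤ (n : ℤ) * A := fun π => abs_sum_alpha_le α₁ A hA1 π
  have hY2 : ∀ π, |Y₂ π| ≤ (n : ℤ) * A := fun π => abs_sum_alpha_le α₂ A hA2 π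
  have hX0 : ∀ π, 0 ≤ X π := fun π => sum_nonneg fun _ _ => sq_nonneg _
  have hgG : ∀ δ : ℤ, -((n : ℤ) + n) < δ → δ < (n : ℤ) + n → |g δ| ≤ G := fun δ hd1 hd2 => by
    have := abs_g_le (n := n) α₁ α₂ μ hμ0 δ hd1 hd2; simpa [hgdef, hGdef, hAdef] using this
  have hgen : ∀ θ (σ : Equiv.Perm (Fin (n + n))), |θ| ≤ Θ →
      |∑ p : Fin (n + n), θ * (((σ p : Fin (n + n)) : ℤ) - (p : ℤ)) ^ 2 + ∑ p : Fin (n + n), g (((σ p : Fin (n + n)) : ℤ) - (p : ℤ))| ≤ S := by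
    intro θ σ hθ
    have h1 := abs_sum_sq_displacement_le σ θ
    have h2 := abs_sum_le_of_bound σ g G (fun δ hd1 hd2 => hgG δ (by push_cast at hd1; linarith) (by push_cast at hd2; linarith))
    have h3 := abs_add_le (∑ p : Fin (n + n), θ * (((σ p : Fin (n + n)) : ℤ) - (p : ℤ)) ^ 2)
      (∑ p : Fin (n + n), g (((σ p : Fin (n + n)) : ℤ) - (p : ℤ)))
    have hnn : (0 : ℤ) ≤ ((n : ℤ) + n) * ((n : ℤ) + n) ^ 2 := by positivity
    have h4 : |θ| * (((n : ℤ) + n) * ((n : ℤ) + n) ^ 2) ≤ Θ * (((n : ℤ) + n) * ((n : ℤ) + n) ^ 2) :=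
      mul_le_mul_of_nonneg_right hθ hnn
    push_cast at h1 h2
    linarith
  -- weight of a general permutation and the footrule split
  have hWsplit : ∀ θ (σ : Equiv.Perm (Fin (n + n))), W θ σ =
      (∑ p : Fin (n + n), θ * (((σ p : Fin (n + n)) : ℤ) - (p : ℤ)) ^ 2 + ∑ p : Fin (n + n), g (((σ p : Fin (n + n)) : ℤ) - (p : ℤ)))
        + C * ∑ p : Fin (n + n), |((σ p : Fin (n + n)) : ℤ) - (p : ℤ)| := fun θ σ => weight_split α₁ α₂ μ C θ σ
  have hC0 : 0 ≤ C := by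
    have : 0 ≤ S := le_trans (abs_nonneg _) (hgen 0 1 (by simp [hΘdef]; positivity))
    linarith
  -- KEY COMPARISON 1: a non-bipartite competitor loses against any bipartite permutation, at any slope |θ| ≤ Θ
  have hnonbip : ∀ θ (π ρ : Equiv.Perm (Fin n)) (σ : Equiv.Perm (Fin (n + n))), |θ| ≤ Θ →
      ¬ (∀ p : Fin (n + n), (p : ℕ) < n ↔ n ≤ ((σ p : Fin (n + n)) : ℕ)) → W θ σ < W θ (mk π ρ) := by
    intro θ π ρ σ hθ hnb
    have hFσ : ∑ p : Fin (n + n), |((σ p : Fin (n + n)) : ℤ) - (p : ℤ)| ≤ 2 * (n : ℤ) ^ 2 - 1 := by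
      have hle := footrule_le σ
      rcases lt_or_eq_of_le hle with hlt | heq
      · omega
      · exact absurd (lt_iff_le_of_footrule_eq σ heq) hnb
    have hFm : ∑ p : Fin (n + n), |((mk π ρ p : Fin (n + n)) : ℤ) - (p : ℤ)| = 2 * (n : ℤ) ^ 2 :=
      footrule_eq_of_bipartite _ (bipartite_of_halves π ρ _ (hmkl π ρ) (hmkr π ρ))
    have hb1 := hgen θ σ hθ
    have hb2 := hgen θ (mk π ρ) hθ
    rw [hWsplit, hWsplit, hFm]
    rw [abs_le] at hb1 hb2
    have hm := mul_le_mul_of_nonneg_left hFσ hC0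
    linarith
  -- unique squared-displacement facts
  have hXid : X 1 = 0 := by simp [X]
  have hXpos : ∀ ρ : Equiv.Perm (Fin n), ρ ≠ 1 → 1 ≤ X ρ := fun ρ hρ => one_le_sq_displacement_sum hρ
  have hXrev : ∀ π : Equiv.Perm (Fin n), π ≠ Fin.revPerm → X π + 1 ≤ X Fin.revPerm := fun π hπ => sq_displacement_sum_succ_le_rev hπ
  -- KEY COMPARISON 2 (phase 1): at slope θ₁ k, (τ₁ k, id) beats every other bipartite permutation
  have hph1 : ∀ (k : Fin (K₁ + 1)) (π ρ : Equiv.Perm (Fin n)), (π, ρ) ≠ (τ₁ k, 1) →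
      W (θ₁ k) (mk π ρ) < W (θ₁ k) (mk (τ₁ k) 1) := by
    intro k π ρ hne
    rw [hWmk, hWmk, hXid]
    have hθk : |θ₁ k| ≤ Θ₁ := hΘ₁ k
    -- first bracket
    have hb1 : θ₁ k * X π + Y₁ π ≤ θ₁ k * X (τ₁ k) + Y₁ (τ₁ k) ∧ (π ≠ τ₁ k → θ₁ k * X π + Y₁ π < θ₁ k * X (τ₁ k) + Y₁ (τ₁ k)) := by
      constructor
      · by_cases hπ : π = τ₁ k
        · rw [hπ]
        · have := hopt₁ k π hπ; rw [hW1, hW1] at this; exact this.le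
      · intro hπ; have := hopt₁ k π hπ; rw [hW1, hW1] at this; exact this
    -- second bracket: ρ versus the identity at effective slope θ₁ k − μ ≪ 0
    have hb2 : (θ₁ k - μ) * X ρ + Y₂ ρ ≤ Y₂ 1 ∧ (ρ ≠ 1 → (θ₁ k - μ) * X ρ + Y₂ ρ < Y₂ 1) := by
      have hy := hY2 ρ; have hy1 := hY2 1
      rw [abs_le] at hy hy1 hθk
      have hneg : θ₁ k - μ ≤ 0 := by linarith
      have key : ρ ≠ 1 → (θ₁ k - μ) * X ρ + Y₂ ρ < Y₂ 1 := fun hρ => by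
        have hx := hXpos ρ hρ
        have hm := mul_le_mul_of_nonpos_left hx hneg
        linarith
      constructor
      · by_cases hρ : ρ = 1
        · rw [hρ, hXid]; simp
        · exact (key hρ).le
      · exact key
    rcases hb1 with ⟨hb1le, hb1lt⟩
    rcases hb2 with ⟨hb2le, hb2lt⟩
    by_cases hπ : π = τ₁ k
    · have hρ : ρ ≠ 1 := fun h => hne (by rw [hπ, h])
      have := hb2lt hρ; rw [hπ]; linarith [hX0 ρ]
    · have := hb1lt hπ; linarith [hX0 ρ]
  -- KEY COMPARISON 3 (phase 2): at slope μ + θ₂ j, (rev, τ₂ j) beats every other bipartite permutation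
  have hph2 : ∀ (j : Fin (K₂ + 1)) (π ρ : Equiv.Perm (Fin n)), (π, ρ) ≠ (Fin.revPerm, τ₂ j) →
      W (μ + θ₂ j) (mk π ρ) < W (μ + θ₂ j) (mk Fin.revPerm (τ₂ j)) := by
    intro j π ρ hne
    rw [hWmk, hWmk]
    have hθj : |θ₂ j| ≤ Θ₂ := hΘ₂ j
    have hb1 : (μ + θ₂ j) * X π + Y₁ π ≤ (μ + θ₂ j) * X Fin.revPerm + Y₁ Fin.revPerm ∧
        (π ≠ Fin.revPerm → (μ + θ₂ j) * X π + Y₁ π < (μ + θ₂ j) * X Fin.revPerm + Y₁ Fin.revPerm) := by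
      have hy := hY1 π; have hy1 := hY1 Fin.revPerm
      rw [abs_le] at hy hy1 hθj
      have hpos : 0 ≤ μ + θ₂ j := by linarith
      have key : π ≠ Fin.revPerm → (μ + θ₂ j) * X π + Y₁ π < (μ + θ₂ j) * X Fin.revPerm + Y₁ Fin.revPerm := fun hπ => by
        have hx := hXrev π hπ
        have hm := mul_le_mul_of_nonneg_left hx hpos
        linarith
      constructor
      · by_cases hπ : π = Fin.revPerm
        · rw [hπ]
        · exact (key hπ).le
      · exact key
    have hb2 : (μ + θ₂ j - μ) * X ρ + Y₂ ρ ≤ (μ + θ₂ j - μ) * X (τ₂ j) + Y₂ (τ₂ j) ∧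
        (ρ ≠ τ₂ j → (μ + θ₂ j - μ) * X ρ + Y₂ ρ < (μ + θ₂ j - μ) * X (τ₂ j) + Y₂ (τ₂ j)) := by
      rw [show μ + θ₂ j - μ = θ₂ j by ring]
      constructor
      · by_cases hρ : ρ = τ₂ j
        · rw [hρ]
        · have := hopt₂ j ρ hρ; rw [hW2, hW2] at this; exact this.le
      · intro hρ; have := hopt₂ j ρ hρ; rw [hW2, hW2] at this; exact this
    rcases hb1 with ⟨hb1le, hb1lt⟩
    rcases hb2 with ⟨hb2le, hb2lt⟩
    by_cases hπ : π = Fin.revPerm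
    · have hρ : ρ ≠ τ₂ j := fun h => hne (by rw [hπ, h])
      have := hb2lt hρ; rw [hπ]; linarith
    · have := hb1lt hπ; linarith
  -- the chain: index k ≤ K₁ ↦ phase 1, k > K₁ ↦ phase 2 with j = k − K₁ ≥ 1
  let θ'' : Fin (K₁ + K₂ + 1) → ℤ := fun k =>
    if h : (k : ℕ) ≤ K₁ then θ₁ ⟨k, by omega⟩ else μ + θ₂ ⟨k - K₁, by omega⟩
  let τ'' : Fin (K₁ + K₂ + 1) → Equiv.Perm (Fin (n + n)) := fun k =>
    if h : (k : ℕ) ≤ K₁ then mk (τ₁ ⟨k, by omega⟩) 1 else mk Fin.revPerm (τ₂ ⟨k - K₁, by omega⟩)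
  -- slopes are bounded by Θ and strictly increasing
  have hθ''bd : ∀ k, |θ'' k| ≤ Θ := by
    intro k
    by_cases h : (k : ℕ) ≤ K₁
    · simp only [θ'', dif_pos h]
      have := hΘ₁ ⟨k, by omega⟩; rw [abs_le] at this ⊢; constructor <;> linarith
    · simp only [θ'', dif_neg h]
      have := hΘ₂ ⟨k - K₁, by omega⟩; rw [abs_le] at this ⊢; constructor <;> linarith
  have hθ''mono : StrictMono θ'' := by
    intro i j hij
    have hij' : (i : ℕ) < j := hij
    by_cases hi : (i : ℕ) ≤ K₁ <;> by_cases hj : (j : ℕ) ≤ K₁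
    · simp only [θ'', dif_pos hi, dif_pos hj]
      exact hθ₁ (show (⟨i, by omega⟩ : Fin (K₁ + 1)) < ⟨j, by omega⟩ from Fin.mk_lt_mk.mpr hij')
    · simp only [θ'', dif_pos hi, dif_neg hj]
      have h1 := hΘ₁ ⟨i, by omega⟩; have h2 := hΘ₂ ⟨j - K₁, by omega⟩
      rw [abs_le] at h1 h2
      nlinarith
    · omega
    · simp only [θ'', dif_neg hi, dif_neg hj]
      have : (⟨(i : ℕ) - K₁, by omega⟩ : Fin (K₂ + 1)) < ⟨j - K₁, by omega⟩ := Fin.mk_lt_mk.mpr (by omega)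
      have := hθ₂ this; linarith
  -- member optimality
  have hopt'' : ∀ k (σ : Equiv.Perm (Fin (n + n))), σ ≠ τ'' k → W (θ'' k) σ < W (θ'' k) (τ'' k) := by
    intro k σ hσ
    by_cases hb : ∀ p : Fin (n + n), (p : ℕ) < n ↔ n ≤ ((σ p : Fin (n + n)) : ℕ)
    · obtain ⟨π, ρ, hl, hr⟩ := exists_halves_of_bipartite σ hb
      have hσeq : σ = mk π ρ := eq_mkBip_of_apply π ρ σ hl hr
      rw [hσeq] at hσ ⊢
      by_cases h : (k : ℕ) ≤ K₁
      · simp only [θ'', τ'', dif_pos h] at hσ ⊢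
        refine hph1 ⟨k, by omega⟩ π ρ fun hpr => hσ ?_
        rw [Prod.mk.injEq] at hpr; rw [hpr.1, hpr.2]
      · simp only [θ'', τ'', dif_neg h] at hσ ⊢
        refine hph2 ⟨k - K₁, by omega⟩ π ρ fun hpr => hσ ?_
        rw [Prod.mk.injEq] at hpr; rw [hpr.1, hpr.2]
    · by_cases h : (k : ℕ) ≤ K₁
      · simp only [θ'', τ'', dif_pos h]
        exact hnonbip _ _ _ σ (by have := hθ''bd k; simpa [θ'', dif_pos h] using this) hb
      · simp only [θ'', τ'', dif_neg h]
        exact hnonbip _ _ _ σ (by have := hθ''bd k; simpa [θ'', dif_neg h] using this) hb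
  -- injectivity of the member list via the strictly increasing squared displacement
  have hXmk : ∀ π ρ, ∑ p : Fin (n + n), (((mk π ρ p : Fin (n + n)) : ℤ) - (p : ℤ)) ^ 2 = 2 * (n : ℤ) ^ 3 + X π + X ρ :=
    fun π ρ => sq_sum_bip π ρ (mk π ρ) (hmkl π ρ) (hmkr π ρ)
  have hX1mono := sq_displacement_sum_strictMono_of_chain α₁ θ₁ τ₁ hθ₁ hτ₁ hopt₁
  have hX2mono := sq_displacement_sum_strictMono_of_chain α₂ θ₂ τ₂ hθ₂ hτ₂ hopt₂
  have hinj'' : Function.Injective τ'' := by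
    have hsm : StrictMono fun k => ∑ p : Fin (n + n), (((τ'' k p : Fin (n + n)) : ℤ) - (p : ℤ)) ^ 2 := by
      intro i j hij
      have hij' : (i : ℕ) < j := hij
      by_cases hi : (i : ℕ) ≤ K₁ <;> by_cases hj : (j : ℕ) ≤ K₁
      · simp only [τ'', dif_pos hi, dif_pos hj, hXmk, hXid]
        have := hX1mono (show (⟨i, by omega⟩ : Fin (K₁ + 1)) < ⟨j, by omega⟩ from Fin.mk_lt_mk.mpr hij')
        simp only at this; linarith
      · simp only [τ'', dif_pos hi, dif_neg hj, hXmk, hXid]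
        -- X(τ₁ i) ≤ X(rev) and X(τ₂ (j-K₁)) ≥ 1 since j − K₁ ≥ 1 forces τ₂ (j-K₁) ≠ id
        have hle : X (τ₁ ⟨i, by omega⟩) ≤ X Fin.revPerm := by
          by_cases hr : τ₁ ⟨i, by omega⟩ = Fin.revPerm
          · rw [hr]
          · have := hXrev _ hr; linarith
        have hne : τ₂ ⟨j - K₁, by omega⟩ ≠ 1 := by
          intro h1
          have := eq_zero_of_chain_eq_one α₂ θ₂ τ₂ hθ₂ hτ₂ hopt₂ h1
          rw [Fin.ext_iff] at this; simp only [Fin.val_zero] at this; omega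
        have := hXpos _ hne
        linarith
      · omega
      · simp only [τ'', dif_neg hi, dif_neg hj, hXmk]
        have : (⟨(i : ℕ) - K₁, by omega⟩ : Fin (K₂ + 1)) < ⟨j - K₁, by omega⟩ := Fin.mk_lt_mk.mpr (by omega)
        have := hX2mono this; simp only at this; linarith
    intro i j h
    apply hsm.injective
    show (∑ p : Fin (n + n), (((τ'' i p : Fin (n + n)) : ℤ) - (p : ℤ)) ^ 2) = ∑ p : Fin (n + n), (((τ'' j p : Fin (n + n)) : ℤ) - (p : ℤ)) ^ 2
    rw [h]
  -- apply the bound to the doubled chain: contradiction with the lengths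
  have hfinal : K₁ + K₂ + 1 ≤ N₁ + N₂ := hB α' (K₁ + K₂) θ'' τ'' hθ''mono hinj'' hopt''
  omega

/-- **THE BIPARTITE DOUBLING LAW** for the quadratic-slope class of the cell's Conjecture Q / T:
`¬ FixedSlopeInstanceBound n (·²) N₁ → ¬ FixedSlopeInstanceBound n (·²) N₂ → ¬ FixedSlopeInstanceBound (n+n) (·²) (N₁+N₂)`, i.e.
`Φ_Q(2n) ≥ Φ_Q(n) + Φ_Q(n)′ − 1` (two size-`n` chains with `N₁+1` and `N₂+1` members give one size-`2n` chain with `N₁+N₂+1` members). -/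
theorem fixedSlope_sq_doubling {N₁ N₂ : ℕ}
    (h₁ : ¬ FixedSlopeInstanceBound n (fun δ : ℤ => δ ^ 2) N₁)
    (h₂ : ¬ FixedSlopeInstanceBound n (fun δ : ℤ => δ ^ 2) N₂) :
    ¬ FixedSlopeInstanceBound (n + n) (fun δ : ℤ => δ ^ 2) (N₁ + N₂) := by
  rw [fixedSlopeInstanceBound_iff_free] at h₁ h₂ ⊢
  exact not_fixedSlopeFree_sq_double h₁ h₂

/-- the law in `Φ`-language: if `Φ_Q(n+n) ≤ Φ` then for all `N₁ N₂` with `N₁ + N₂ ≥ Φ`, one of `Φ_Q(n) ≤ N₁`, `Φ_Q(n) ≤ N₂` holds. -/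
theorem fixedSlopeInstanceBound_sq_half {N₁ N₂ : ℕ} (h : FixedSlopeInstanceBound (n + n) (fun δ : ℤ => δ ^ 2) (N₁ + N₂)) :
    FixedSlopeInstanceBound n (fun δ : ℤ => δ ^ 2) N₁ ∨ FixedSlopeInstanceBound n (fun δ : ℤ => δ ^ 2) N₂ := by
  by_contra hh; push Not at hh
  exact fixedSlope_sq_doubling hh.1 hh.2 h

/-- **Every kernel row doubles**: with the row `Φ_Q(20) ≥ 79` (`le_of_fixedSlopeInstanceBound_sq_twenty_79`, this seat) the law gives
`Φ_Q(40) ≥ 157`, `Φ_Q(80) ≥ 313`, … — stated here for the first step as a sample. -/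
theorem not_fixedSlopeInstanceBound_sq_forty_156 (h20 : ¬ FixedSlopeInstanceBound 20 (fun δ : ℤ => δ ^ 2) 78) :
    ¬ FixedSlopeInstanceBound (20 + 20) (fun δ : ℤ => δ ^ 2) (78 + 78) :=
  fixedSlope_sq_doubling h20 h20

end Doubling

end Summit.ValiantsHypothesis.ValiantsHypothesis.Theorems.KPlusLogSqLaw.Toeplitz
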